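import Summits.QuantumFields.BalabanUV.Beta.EriceRemainderEnclosureHistoryAutonomyComparisonAgeCompositionYoungPairMomentRefined

/-!
# EriceRemainderEnclosureHistoryAutonomyComparisonAgeCompositionYoungPairMomentCoupled — (E94h) route (N), first order: THE OLD AGE'S OWN READS INSIDE
# THE YOUNG PAIR'S LETTERS.  (E94b)∕(E94d) drop the old age's reads from the step and window letters and charge its load at the own-window cap `so`
# independently; for `11 ≤ k₂ ≤ 16` and `57 ≤ k₃ < 90` that decoupling is what fails (the worst vertex has the middle load large, the pair's window
# letter tight, AND the old load at its cap).  Keeping the old reads — `(2r_k∕k₃)σ²·z` in the step letter (`r_k²(k₃+1) ≤ k₃`) and `(2k₂r_{jk}∕k₃)σ³·z` in every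
# window letter (`r_{jk}²(k₃+k₂) ≤ k₃`; `h_{m+k₂} ≥ h_{m+k₃}`) — makes the END follow from ONE BILINEAR inequality
# `(1−x−y)(1−z) ≥ (4z∕k₃)(x + (k₂+1)y∕2)` on the joint polytope in `(x,y,z)`, linear on every box of `(σ, z)`: numerically its margin is `≥ 0.067` for all
# `11 ≤ k₂ ≤ 16`, `k₃ ≥ 57` (`g84/numerics/zcouple.py`); the rational certificates (5∕6∕6∕11∕11∕23 boxes, `coupled_cert.py`) and the closed rows are in the
# sequel (E94i)

Cell `pub-balaban`, β-function sub-cell, BINDER row D4 «RemainderConst leaves for Bałaban's split» (`HOME/BINDER-OWNERS.md`; owner lineage `b2b-balaban-beta-an4`;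
this file by co-owner #2 lineage `b2b-balaban-beta-d4-p2`, generation 84), β-FLOW TEAM duty (1), FREEZE (0) honoured (def-free; nothing restated).

HONEST FRAMING (page 1, verbatim and binding).  *"Discharging BetaPertH makes Bałaban's UV stability UNCONDITIONAL — a real constructive-QFT result; it is
NOT the continuum limit and NOT the Clay problem."*  THIS FILE DISCHARGES NOTHING OF THE KIND.  Elementary real algebra ∕ real analysis about ABSTRACT
functionals on a box ]0,γ]^ℕ with displayed floors, profiles and signs, and the FIRST-ORDER renewal objects of route (N) built from them — hypotheses of a
census, not facts; the form, signs, ages and moments of Bałaban's (1.22) limit functional are NOT PRINTED ([I] p. 298; GAPS G-t4-U2-1∕-2) and NOT asserted.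
Row D4 class UNCHANGED (critical-path width 0; instance 0∕1; D4 DISCHARGE NO DATE).  HONEST DEPENDENCY: continuum YM on T⁴ ⇐ BetaPertH ∧ nine spine
estimates (0/9 proved); BetaPertH ⇐ (D1) ∧ (D4) ∧ CAP+tail; G-an2-4 gates asym, D1 and NE2/3/4.

THE POINT (README `HOME/b2b-balaban-beta-d4-p2/g84/README.md` §2, §4).  Uses (E94d) `ray_le`, (E94b) `young_pair_letters`∕`load_le_of_sq`, (E92c)
`residual_step_moment`∕`row_moment_le`, (E92a) `renewal_bounds_of_step`, (E91a) `old_read_variation`, (E88d) `invSq_sub_ge_all_reads`, (E82a)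
`kernel_entry_le`∕`row_mass_le`, (E80b) `aggregate_eq_sum` BY NAME.  NOT CLAIMED: anything printed — NOT B12 Thm 2, NOT BetaPertH, NOT continuum, NOT Clay.

WHAT IS PROVED ([folklore]; 0 `def`, 0 sorry).  §1 `three_terms_le_reads`, **`coupled_letters`** (step and window letters with the old age's terms).  §2
**`flow_nonneg_three_ages_young_pair_moment_coupled`** (parametric: IF the bilinear inequality holds on the joint polytope THEN the END).
-/
noncomputable section
open Finset

namespace Summit.QuantumFields.BalabanUV.Beta.EriceRemainderEnclosureHistoryAutonomyComparisonAgeCompositionYoungPairMomentCoupled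

open Literature.MathematicalPhysics.QuantumFieldTheory.Balaban1983to89
open Literature.MathematicalPhysics.QuantumFieldTheory.Balaban1983to89.T4BetaStationary
open Literature.MathematicalPhysics.QuantumFieldTheory.Balaban1983to89.T4BetaFlowWellPosed
open Summit.QuantumFields.BalabanUV.Beta.EriceRemainderEnclosureHistoryAutonomyOrder (strictAnti_of_memFlow)
open Summit.QuantumFields.BalabanUV.Beta.EriceRemainderEnclosureHistoryAutonomyComparisonAgeCompositionWindowShares (mul_sq_le_from_pin)
open Summit.QuantumFields.BalabanUV.Beta.EriceRemainderEnclosureHistoryAutonomyComparisonAgeCompositionThreeAgesFlowReads (invSq_sub_ge_all_reads)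
open Summit.QuantumFields.BalabanUV.Beta.EriceRemainderEnclosureHistoryAutonomyComparisonAgeCompositionYoungestTailSumFlow
  (kernel_entry_le row_mass_le)
open Summit.QuantumFields.BalabanUV.Beta.EriceRemainderEnclosureHistoryAutonomyComparisonAgeCompositionChainWiring (aggregate_eq_sum)
open Summit.QuantumFields.BalabanUV.Beta.EriceRemainderEnclosureHistoryAutonomyComparisonAgeCompositionTwoAgesOldRead (old_read_variation)
open Summit.QuantumFields.BalabanUV.Beta.EriceRemainderEnclosureHistoryAutonomyComparisonAgeCompositionNestedReads (renewal_bounds_of_step)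
open Summit.QuantumFields.BalabanUV.Beta.EriceRemainderEnclosureHistoryAutonomyComparisonAgeCompositionNestedMoments
  (residual_step_moment row_moment_le)
open Summit.QuantumFields.BalabanUV.Beta.EriceRemainderEnclosureHistoryAutonomyComparisonAgeCompositionYoungPairMoment
  (load_le_of_sq young_pair_letters)
open Summit.QuantumFields.BalabanUV.Beta.EriceRemainderEnclosureHistoryAutonomyComparisonAgeCompositionYoungPairMomentRefined (ray_le)

variable {B : (ℕ → ℝ) → ℝ} {γ b gIR : ℝ} {L : ℕ → ℝ} {K : ℕ} {h g : ℕ → ℝ}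

/-! ## §1 The letters of the young pair with the old age's reads kept -/

/-- Three terms of the window reads: for pairwise distinct ages `i, j, k < K` and any pin `n`, `L_ih(n+i) + L_jh(n+j) + L_kh(n+k) ≤ Σ_{l<K} L_lh(n+l)`
(`L ≥ 0`, `h > 0`). [folklore] -/
theorem three_terms_le_reads (hL : ∀ k, 0 ≤ L k) (hh : SeqBox γ h) {i j k : ℕ} (hij : i ≠ j) (hik : i ≠ k) (hjk : j ≠ k) (hiK : i < K)
    (hjK : j < K) (hkK : k < K) (n : ℕ) : L i * h (n + i) + L j * h (n + j) + L k * h (n + k) ≤ ∑ l ∈ range K, L l * h (n + l) := by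
  have hpos : ∀ n, 0 < h n := fun n => (hh n).1
  have hsub : ({i, j, k} : Finset ℕ) ⊆ range K := by
    intro x hx
    simp only [mem_insert, mem_singleton] at hx
    rw [mem_range]; rcases hx with rfl | rfl | rfl <;> assumption
  have := sum_le_sum_of_subset_of_nonneg hsub (f := fun l => L l * h (n + l)) fun l _ _ => mul_nonneg (hL l) (hpos _).le
  rwa [sum_insert (by simp only [mem_insert, mem_singleton, not_or]; exact ⟨hij, hik⟩), sum_pair hjk, ← add_assoc] at this

/-- **THE COUPLED LETTERS OF THE YOUNG PAIR.**  Ages `1 < j < K` (any others allowed, `L ≥ 0`); `σ = h_{m+1}∕h_{m+j}`, `x = L_1h_{m+1}³∕2`,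
`y = j·L_jh_{m+j}³∕2`; `ρ²(j+1) ≤ j`; young ray constants `s_u²(u+2) ≤ 1` (`u+2 ≤ j`), middle ray constants `r_q²(j+1+q) ≤ j` (`q < j`).  For every
`U ≤ j−1`, with the OLD age `k > j` kept (`z = k·L_kh_{m+k}³∕2`, `r_{jk}²(k+j) ≤ k`): the WINDOW letter
`2(Σ_{u<U} s_u)σ·x + 2(j−1−U+ρ)·x + (2Σ_{q<j} r_q∕j)σ³·y + (2j·r_{jk}∕k)σ³·z ≤ σ³` (the old age reads `≥ j·L_k·r_{jk}h_{m+k}` inside `[m, m+j)`, and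
`h_{m+j} ≥ h_{m+k}`), and the STEP letter `1.41421x + (2ρ∕j)σ²y + (2r_k∕k)σ²z ≤ 1` (`r_k²(k+1) ≤ k`). [folklore] -/
theorem coupled_letters (hmono : ∀ u v : ℕ → ℝ, SeqBox γ u → SeqBox γ v → (∀ j, u j ≤ v j) → B u ≤ B v)
    (hL : ∀ k, 0 ≤ L k) (hb : 0 < b) (hlo : ∀ u, SeqBox γ u → b ≤ B u) (hdom : ∀ u, SeqBox γ u → ∑ k ∈ range K, L k * u k ≤ B u)
    (hh : SeqBox γ h) (hf : MemFlow B gIR h) {j k : ℕ} (hj : 2 ≤ j) (hjk : j < k) (hkK : k < K) {ρ rk rjk : ℝ} {s r : ℕ → ℝ}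
    (hρ : ρ ^ 2 * ((j : ℝ) + 1) ≤ j) (hrk0 : 0 ≤ rk) (hrk : rk ^ 2 * ((k : ℝ) + 1) ≤ k) (hrjk0 : 0 ≤ rjk)
    (hrjk : rjk ^ 2 * ((k : ℝ) + j) ≤ k)
    (hs : ∀ u, u + 2 ≤ j → s u ^ 2 * ((u : ℝ) + 2) ≤ 1) (hr : ∀ q, q < j → r q ^ 2 * ((j : ℝ) + 1 + q) ≤ j) {U : ℕ} (hU : U + 1 ≤ j)
    (m : ℕ) :
    (141421 : ℝ) / 100000 * (L 1 * h (m + 1) ^ 3 / 2) + 2 * ρ / j * (h (m + 1) / h (m + j)) ^ 2 * ((j : ℝ) * (L j * h (m + j) ^ 3 / 2))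
        + 2 * rk / k * (h (m + 1) / h (m + j)) ^ 2 * ((k : ℝ) * (L k * h (m + k) ^ 3 / 2)) ≤ 1
    ∧ 2 * (∑ u ∈ range U, s u) * (h (m + 1) / h (m + j)) * (L 1 * h (m + 1) ^ 3 / 2) + 2 * ((j : ℝ) - 1 - U + ρ) * (L 1 * h (m + 1) ^ 3 / 2)
      + 2 * (∑ q ∈ range j, r q) / j * (h (m + 1) / h (m + j)) ^ 3 * ((j : ℝ) * (L j * h (m + j) ^ 3 / 2))
      + 2 * j * rjk / k * (h (m + 1) / h (m + j)) ^ 3 * ((k : ℝ) * (L k * h (m + k) ^ 3 / 2))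
      ≤ (h (m + 1) / h (m + j)) ^ 3 := by
  have hpos : ∀ n, 0 < h n := fun n => (hh n).1
  have hanti := (strictAnti_of_memFlow hb hlo hh hf).antitone
  have h1K : 1 < K := by omega
  have hjK : j < K := by omega
  have hjr : (0 : ℝ) < j := by exact_mod_cast (show 0 < j by omega)
  have hkr : (0 : ℝ) < k := by exact_mod_cast (show 0 < k by omega)
  have hm1 := hpos (m + 1); have hmj := hpos (m + j); have hmk := hpos (m + k)
  have hL1 := hL 1; have hLj := hL j; have hLk := hL k
  have hjk' : h (m + k) ≤ h (m + j) := hanti (by omega)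
  have hσpos : 0 < h (m + 1) / h (m + j) := div_pos hm1 hmj
  -- the old age one step ∕ j steps inside its reads: h_{m+k+1} ≥ r_k h_{m+k}, h_{m+k+j} ≥ r_{jk} h_{m+k}
  have hrk1 : rk * h (m + k) ≤ h (m + k + 1) := ray_le hmono hb hlo hh hf m (j := k) (by omega) 1 (by push_cast; linarith)
  have hrkj : rjk * h (m + k) ≤ h (m + k + j) := ray_le hmono hb hlo hh hf m (j := k) (by omega) j (by linarith)
  refine ⟨?_, ?_⟩
  · -- THE STEP LETTER with the old term
    obtain ⟨-, -, hP1, -⟩ := young_pair_letters hmono hL hb hlo hdom hh hf hj hjK hρ (ζ := 0) (by rw [zero_pow two_ne_zero, zero_mul]; positivity) m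
    -- redo the step with three terms: L_1h_{m+2} + L_jh_{m+j+1} + L_kh_{m+k+1} ≤ 1∕h_{m+1}²
    have hstep : L 1 * h (m + 2) + L j * h (m + j + 1) + L k * h (m + k + 1) ≤ 1 / h (m + 1) ^ 2 := by
      have e1 := invSq_sub_ge_all_reads hdom hh hf m 1
      rw [sum_range_one] at e1
      have e2 := three_terms_le_reads hL hh (show 1 ≠ j by omega) (show 1 ≠ k by omega) (show j ≠ k by omega) h1K hjK hkK (m + 0 + 1)
      rw [show m + 0 + 1 + 1 = m + 2 by ring, show m + 0 + 1 + j = m + j + 1 by ring, show m + 0 + 1 + k = m + k + 1 by ring] at e2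
      have e3 : 0 < 1 / h m ^ 2 := by have := hpos m; positivity
      linarith
    -- the first two terms are those of `young_pair_letters`; it suffices to bound the third from below
    have h2 : (141421 : ℝ) / 200000 * h (m + 1) ≤ h (m + 2) := by
      have := mul_sq_le_from_pin hmono hb hlo hh hf m 1 1
      push_cast at this
      have hsq : ((141421 : ℝ) / 200000 * h (m + 1)) ^ 2 ≤ h (m + 2) ^ 2 := by rw [mul_pow]; nlinarith [sq_nonneg (h (m + 1))]
      exact le_of_pow_le_pow_left₀ two_ne_zero (hpos _).le hsq
    have hρj : ρ * h (m + j) ≤ h (m + j + 1) := ray_le hmono hb hlo hh hf m (j := j) (by omega) 1 (by push_cast; linarith)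
    have hA : (141421 : ℝ) / 100000 * (L 1 * h (m + 1) ^ 3 / 2) ≤ h (m + 1) ^ 2 * (L 1 * h (m + 2)) := by
      have := mul_le_mul_of_nonneg_left h2 (mul_nonneg hL1 (sq_nonneg (h (m + 1))))
      nlinarith [this]
    have hB : 2 * ρ / j * (h (m + 1) / h (m + j)) ^ 2 * ((j : ℝ) * (L j * h (m + j) ^ 3 / 2)) ≤ h (m + 1) ^ 2 * (L j * h (m + j + 1)) := by
      have e : 2 * ρ / j * (h (m + 1) / h (m + j)) ^ 2 * ((j : ℝ) * (L j * h (m + j) ^ 3 / 2)) = h (m + 1) ^ 2 * (L j * (ρ * h (m + j))) := by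
        field_simp
      rw [e]
      exact mul_le_mul_of_nonneg_left (mul_le_mul_of_nonneg_left hρj hLj) (sq_nonneg _)
    have hC : 2 * rk / k * (h (m + 1) / h (m + j)) ^ 2 * ((k : ℝ) * (L k * h (m + k) ^ 3 / 2)) ≤ h (m + 1) ^ 2 * (L k * h (m + k + 1)) := by
      have e : 2 * rk / k * (h (m + 1) / h (m + j)) ^ 2 * ((k : ℝ) * (L k * h (m + k) ^ 3 / 2))
          = h (m + 1) ^ 2 * (L k * (rk * h (m + k))) * (h (m + k) / h (m + j)) ^ 2 := by
        field_simp
      rw [e]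
      have hratio : (h (m + k) / h (m + j)) ^ 2 ≤ 1 := by
        rw [div_pow, div_le_one (pow_pos hmj 2)]; exact pow_le_pow_left₀ hmk.le hjk' 2
      have hnn : 0 ≤ h (m + 1) ^ 2 * (L k * (rk * h (m + k))) := by positivity
      calc h (m + 1) ^ 2 * (L k * (rk * h (m + k))) * (h (m + k) / h (m + j)) ^ 2 ≤ h (m + 1) ^ 2 * (L k * (rk * h (m + k))) :=
            mul_le_of_le_one_right hnn hratio
        _ ≤ h (m + 1) ^ 2 * (L k * h (m + k + 1)) := mul_le_mul_of_nonneg_left (mul_le_mul_of_nonneg_left hrk1 hLk) (sq_nonneg _)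
    have hD : h (m + 1) ^ 2 * (L 1 * h (m + 2)) + h (m + 1) ^ 2 * (L j * h (m + j + 1)) + h (m + 1) ^ 2 * (L k * h (m + k + 1)) ≤ 1 := by
      rw [← mul_add, ← mul_add]
      have := mul_le_mul_of_nonneg_left hstep (sq_nonneg (h (m + 1)))
      rwa [mul_one_div, div_self (pow_pos hm1 2).ne'] at this
    linarith
  · -- THE WINDOW LETTER with the old term
    have hwin : ∑ q ∈ range j, L 1 * h (m + q + 2) + ∑ q ∈ range j, L j * h (m + j + 1 + q) + ∑ q ∈ range j, L k * h (m + q + 1 + k)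
        ≤ 1 / h (m + j) ^ 2 := by
      have e1 := invSq_sub_ge_all_reads hdom hh hf m j
      have e2 : ∑ q ∈ range j, (L 1 * h (m + q + 2) + L j * h (m + j + 1 + q) + L k * h (m + q + 1 + k))
          ≤ ∑ q ∈ range j, ∑ i ∈ range K, L i * h (m + q + 1 + i) :=
        sum_le_sum fun q _ => by
          have := three_terms_le_reads hL hh (show 1 ≠ j by omega) (show 1 ≠ k by omega) (show j ≠ k by omega) h1K hjK hkK (m + q + 1)
          rwa [show m + q + 1 + 1 = m + q + 2 by ring, show m + q + 1 + j = m + j + 1 + q by ring] at this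
      have e3 : 0 < 1 / h m ^ 2 := by have := hpos m; positivity
      rw [← sum_add_distrib, ← sum_add_distrib]
      linarith
    -- the young reads: split range j = range U ∪ Ico U (j−1) ∪ {j−1}
    have hρj : ρ * h (m + j) ≤ h (m + j + 1) := ray_le hmono hb hlo hh hf m (j := j) (by omega) 1 (by push_cast; linarith)
    have hY : L 1 * (h (m + 1) * ∑ u ∈ range U, s u) + L 1 * h (m + j) * ((j : ℝ) - 1 - U) + L 1 * (ρ * h (m + j))
        ≤ ∑ q ∈ range j, L 1 * h (m + q + 2) := by
      obtain ⟨j', rfl⟩ : ∃ j', j = j' + 1 := ⟨j - 1, by omega⟩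
      have hUj' : U ≤ j' := by omega
      rw [sum_range_succ, show m + j' + 2 = m + (j' + 1) + 1 by ring, ← sum_range_add_sum_Ico _ hUj']
      have hA : L 1 * (h (m + 1) * ∑ u ∈ range U, s u) ≤ ∑ q ∈ range U, L 1 * h (m + q + 2) := by
        rw [mul_sum, mul_sum]
        refine sum_le_sum fun u hu => mul_le_mul_of_nonneg_left ?_ hL1
        have hu2 : u + 2 ≤ j' + 1 := by have := mem_range.mp hu; omega
        have := ray_le hmono hb hlo hh hf m (j := 1) le_rfl (u + 1) (r := s u) (by push_cast; have := hs u hu2; linarith)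
        rw [show m + 1 + (u + 1) = m + u + 2 by ring] at this
        linarith
      have hB : L 1 * h (m + (j' + 1)) * (((j' : ℕ) + 1 : ℝ) - 1 - U) ≤ ∑ q ∈ Ico U j', L 1 * h (m + q + 2) := by
        have h1 : ∑ q ∈ Ico U j', L 1 * h (m + (j' + 1)) ≤ ∑ q ∈ Ico U j', L 1 * h (m + q + 2) :=
          sum_le_sum fun q hq => mul_le_mul_of_nonneg_left (hanti (by have := (mem_Ico.mp hq).2; omega)) hL1
        rw [sum_const, Nat.card_Ico, nsmul_eq_mul, Nat.cast_sub hUj'] at h1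
        linarith
      have hC := mul_le_mul_of_nonneg_left hρj hL1
      push_cast at hB ⊢
      linarith
    -- the middle's own window, term by term
    have hM : L j * (h (m + j) * ∑ q ∈ range j, r q) ≤ ∑ q ∈ range j, L j * h (m + j + 1 + q) := by
      rw [mul_sum, mul_sum]
      refine sum_le_sum fun q hq => mul_le_mul_of_nonneg_left ?_ hLj
      have := ray_le hmono hb hlo hh hf m (j := j) (by omega) (q + 1) (r := r q) (by push_cast; have := hr q (mem_range.mp hq); linarith)
      rw [show m + j + (q + 1) = m + j + 1 + q by ring] at this
      linarith
    -- the old age's reads inside the middle window: each ≥ L_k h_{m+k+j} ≥ L_k r_{jk} h_{m+k}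
    have hO : L k * ((j : ℝ) * (rjk * h (m + k))) ≤ ∑ q ∈ range j, L k * h (m + q + 1 + k) := by
      have h1 : ∑ q ∈ range j, L k * (rjk * h (m + k)) ≤ ∑ q ∈ range j, L k * h (m + q + 1 + k) :=
        sum_le_sum fun q hq => mul_le_mul_of_nonneg_left
          (hrkj.trans (by rw [show m + k + j = m + (q + 1 + k) + (j - 1 - q) by have := mem_range.mp hq; omega,
            show m + q + 1 + k = m + (q + 1 + k) by ring]; exact hanti (by omega))) hLk
      rw [sum_const, card_range, nsmul_eq_mul] at h1
      linarith
    -- assemble and multiply by h_{m+j}²·σ³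
    have hsum : L 1 * (h (m + 1) * ∑ u ∈ range U, s u) + L 1 * h (m + j) * ((j : ℝ) - 1 - U) + L 1 * (ρ * h (m + j))
        + L j * (h (m + j) * ∑ q ∈ range j, r q) + L k * ((j : ℝ) * (rjk * h (m + k))) ≤ 1 / h (m + j) ^ 2 := by linarith
    have key := mul_le_mul_of_nonneg_left hsum (le_of_lt (mul_pos (pow_pos hmj 2) (pow_pos hσpos 3)))
    have e1 : h (m + j) ^ 2 * (h (m + 1) / h (m + j)) ^ 3 * (1 / h (m + j) ^ 2) = (h (m + 1) / h (m + j)) ^ 3 := by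
      field_simp
    have e2 : h (m + j) ^ 2 * (h (m + 1) / h (m + j)) ^ 3 * (L 1 * (h (m + 1) * ∑ u ∈ range U, s u) + L 1 * h (m + j) * ((j : ℝ) - 1 - U)
          + L 1 * (ρ * h (m + j)) + L j * (h (m + j) * ∑ q ∈ range j, r q) + L k * ((j : ℝ) * (rjk * h (m + k))))
        = 2 * (∑ u ∈ range U, s u) * (h (m + 1) / h (m + j)) * (L 1 * h (m + 1) ^ 3 / 2) + 2 * ((j : ℝ) - 1 - U + ρ) * (L 1 * h (m + 1) ^ 3 / 2)
          + 2 * (∑ q ∈ range j, r q) / j * (h (m + 1) / h (m + j)) ^ 3 * ((j : ℝ) * (L j * h (m + j) ^ 3 / 2))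
          + (h (m + 1) / h (m + j)) ^ 3 * (L k * ((j : ℝ) * (rjk * h (m + k)))) * h (m + j) ^ 2 := by
      field_simp
      ring
    rw [e1, e2] at key
    -- the old term in the letter is at most the assembled one (h_{m+k} ≤ h_{m+j}, r_{jk} ≥ 0)
    have hold : 2 * j * rjk / k * (h (m + 1) / h (m + j)) ^ 3 * ((k : ℝ) * (L k * h (m + k) ^ 3 / 2))
        ≤ (h (m + 1) / h (m + j)) ^ 3 * (L k * ((j : ℝ) * (rjk * h (m + k)))) * h (m + j) ^ 2 := by
      have e : 2 * j * rjk / k * (h (m + 1) / h (m + j)) ^ 3 * ((k : ℝ) * (L k * h (m + k) ^ 3 / 2))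
          = (h (m + 1) / h (m + j)) ^ 3 * (L k * ((j : ℝ) * (rjk * h (m + k)))) * h (m + k) ^ 2 := by
        field_simp
      rw [e]
      have hnn : 0 ≤ (h (m + 1) / h (m + j)) ^ 3 * (L k * ((j : ℝ) * (rjk * h (m + k)))) := by positivity
      exact mul_le_mul_of_nonneg_left (pow_le_pow_left₀ hmk.le hjk' 2) hnn
    linarith

/-! ## §2 The young pair against the old read, coupled letters -/
set_option maxHeartbeats 400000 in
/-- **THE CENSUS THREE AGES FROM THE COUPLED POLYTOPE (parametric).**  As (E94d) `flow_nonneg_three_ages_young_pair_moment_refined`, with the old load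
`z = x_{k₃}(m) ∈ [0, so]` kept as a variable inside the step and window letters (`coupled_letters`): IF every point of the joint polytope satisfies the
bilinear inequality `(1−x−y)(1−z) ≥ (4z∕k₃)(x + (k₂+1)y∕2)`, THEN `0 ≤ ε ≤ e` at every pin, every horizon, every damping of the self-consistent class
(`ε ≥ [(1−x−y)(1−z) − (x + (k₂+1)y∕2)·4c₃]·e` with `c₃ = z∕k₃`). [folklore] -/
theorem flow_nonneg_three_ages_young_pair_moment_coupled (hmono : ∀ u v : ℕ → ℝ, SeqBox γ u → SeqBox γ v → (∀ j, u j ≤ v j) → B u ≤ B v)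
    (hL : ∀ k, 0 ≤ L k) (hb : 0 < b) (hlo : ∀ u, SeqBox γ u → b ≤ B u) (hdom : ∀ u, SeqBox γ u → ∑ k ∈ range K, L k * u k ≤ B u)
    (hh : SeqBox γ h) (hf : MemFlow B gIR h) (hg : ∀ t, 0 < g t ∧ g t ≤ 1)
    (hgF : ∀ t, 1 ≤ g t * (1 + ∑ k ∈ range K, L k * h (t + k) ^ 3 / 2))
    {k₂ k₃ : ℕ} (hk2 : 2 ≤ k₂) (hk23 : k₂ < k₃) (hk3K : k₃ < K) (hL3 : ∀ j, j < K → j ≠ 1 → j ≠ k₂ → j ≠ k₃ → L j = 0)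
    {ρ rk rjk so : ℝ} {s r : ℕ → ℝ} (hρ : ρ ^ 2 * ((k₂ : ℝ) + 1) ≤ k₂) (hrk0 : 0 ≤ rk) (hrk : rk ^ 2 * ((k₃ : ℝ) + 1) ≤ k₃)
    (hrjk0 : 0 ≤ rjk) (hrjk : rjk ^ 2 * ((k₃ : ℝ) + k₂) ≤ k₃)
    (hs : ∀ u, u + 2 ≤ k₂ → s u ^ 2 * ((u : ℝ) + 2) ≤ 1) (hr : ∀ q, q < k₂ → r q ^ 2 * ((k₂ : ℝ) + 1 + q) ≤ k₂)
    (hso0 : 0 < so) (hso1 : so < 1) (hso : 3 * (k₃ : ℝ) + 1 ≤ 8 * k₃ * so ^ 2)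
    (hcond : ∀ σ x y z : ℝ, 1 ≤ σ → σ ^ 2 ≤ k₂ → 0 ≤ x → 0 ≤ y → 0 ≤ z → z ≤ so →
      (141421 : ℝ) / 100000 * x + 2 * ρ / k₂ * σ ^ 2 * y + 2 * rk / k₃ * σ ^ 2 * z ≤ 1 →
      (∀ U : ℕ, U + 1 ≤ k₂ → 2 * (∑ u ∈ range U, s u) * σ * x + 2 * ((k₂ : ℝ) - 1 - U + ρ) * x
        + 2 * (∑ q ∈ range k₂, r q) / k₂ * σ ^ 3 * y + 2 * k₂ * rjk / k₃ * σ ^ 3 * z ≤ σ ^ 3) →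
      0 ≤ (1 - x - y) * (1 - z) - 4 * z / k₃ * (x + ((k₂ : ℝ) + 1) / 2 * y))
    {N : ℕ} {KL : ℕ → ℕ → ℕ → ℝ}
    (hKL : ∀ k n l, KL k n l = if 0 < k ∧ k < K ∧ l < k then L k * h (n + k) ^ 3 / 2 * ∏ t ∈ Ico (n + 1 + l) (n + k + 1), g t else 0)
    {KA : ℕ → ℕ → ℕ → ℝ} {RA : ℕ → (ℕ → ℝ) → ℕ → ℝ}
    (hRA : ∀ i v m, RA i v m = ∑ l ∈ range K, KA i m l * v (m + 1 + l))
    (hKA : ∀ i m l, KA i m l = KL i m l + KA (i + 1) m l) (hKAtop : ∀ m l, KA K m l = 0)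
    {e ε : ℕ → ℝ} (he0 : ∀ m, 0 ≤ e m) (hea : ∀ m, e (m + 1) ≤ e m)
    (hεt : ∀ m, N < m → ε m = 0) (hεrec : ∀ m, ε m = e m - RA 1 ε m) : ∀ m, 0 ≤ ε m ∧ ε m ≤ e m := by
  have hpos : ∀ n, 0 < h n := fun n => (hh n).1
  have hK : 1 ≤ K := by omega
  have h1K : 1 < K := by omega
  have hk2K : k₂ < K := by omega
  have hj : 0 < k₂ := by omega
  have hk : 0 < k₃ := by omega
  have hL0 : L 0 = 0 := hL3 0 (by omega) (by omega) (by omega) (by omega)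
  have hjr : (2 : ℝ) ≤ k₂ := by exact_mod_cast hk2
  have hkr : (0 : ℝ) < k₃ := by exact_mod_cast hk
  have hea' : ∀ p q, p ≤ q → e q ≤ e p := by
    intro p q hpq
    induction q, hpq using Nat.le_induction with
    | base => exact le_rfl
    | succ q _ ih => exact (hea q).trans ih
  -- the aggregate row is the young pair's rows plus the old row
  have hKA1 : ∀ m l, KA 1 m l = (KL 1 m l + KL k₂ m l) + KL k₃ m l := by
    intro m l
    have h1 : KA 1 m l = ∑ k' ∈ Ico 1 (K - 1 + 1), KL k' m l :=
      aggregate_eq_sum (n := K - 1) hKA (fun m l => by rw [Nat.sub_add_cancel hK]; exact hKAtop m l) (show 1 ≤ K - 1 + 1 by omega) m l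
    rw [h1, Nat.sub_add_cancel hK]
    have hsub : ({1, k₂, k₃} : Finset ℕ) ⊆ Ico 1 K := by
      intro x hx
      simp only [mem_insert, mem_singleton] at hx
      rw [mem_Ico]; rcases hx with rfl | rfl | rfl <;> omega
    rw [← sum_subset hsub (fun x hx hxn => by
      simp only [mem_insert, mem_singleton, not_or] at hxn
      rw [hKL]
      split_ifs
      · rw [hL3 x (mem_Ico.mp hx).2 hxn.1 hxn.2.1 hxn.2.2]; simp
      · rfl), sum_insert (by simp only [mem_insert, mem_singleton]; omega), sum_pair (by omega)]
    ring
  have hrec2 : ∀ p, ε p = e p - ∑ l ∈ range K, (KL 1 p l + KL k₂ p l) * ε (p + 1 + l) - ∑ l ∈ range K, KL k₃ p l * ε (p + 1 + l) := by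
    intro p
    rw [hεrec p, hRA]
    have : ∑ l ∈ range K, KA 1 p l * ε (p + 1 + l)
        = ∑ l ∈ range K, (KL 1 p l + KL k₂ p l) * ε (p + 1 + l) + ∑ l ∈ range K, KL k₃ p l * ε (p + 1 + l) := by
      rw [← sum_add_distrib]; exact sum_congr rfl fun l _ => by rw [hKA1]; ring
    rw [this]; ring
  refine renewal_bounds_of_step he0 hεt fun m IH => ?_
  have hreadY0 : ∀ p, m ≤ p → 0 ≤ ∑ l ∈ range K, (KL 1 p l + KL k₂ p l) * ε (p + 1 + l) := fun p hp =>
    sum_nonneg fun l _ => mul_nonneg (add_nonneg (kernel_entry_le hL hh hg hKL 1 p l).1 (kernel_entry_le hL hh hg hKL k₂ p l).1)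
      (IH _ (by omega)).1
  have hreadO0 : ∀ p, m ≤ p → 0 ≤ ∑ l ∈ range K, KL k₃ p l * ε (p + 1 + l) := fun p hp =>
    sum_nonneg fun l _ => mul_nonneg (kernel_entry_le hL hh hg hKL k₃ p l).1 (IH _ (by omega)).1
  -- the letters at the pin
  set c1 := L 1 * h (m + 1) ^ 3 / 2 with hc1_def
  set c2 := L k₂ * h (m + k₂) ^ 3 / 2 with hc2_def
  set c3 := L k₃ * h (m + k₃) ^ 3 / 2 with hc3_def
  have hc10 : 0 ≤ c1 := by have := hL 1; have := hpos (m + 1); positivity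
  have hc20 : 0 ≤ c2 := by have := hL k₂; have := hpos (m + k₂); positivity
  have hc30 : 0 ≤ c3 := by have := hL k₃; have := hpos (m + k₃); positivity
  have hx3 : (k₃ : ℝ) * c3 ≤ so := load_le_of_sq hmono hL hb hlo hdom hh hf (by omega) hk3K hso0 hso m
  obtain ⟨hσ1, hσ2, -, -⟩ := young_pair_letters hmono hL hb hlo hdom hh hf hk2 hk2K hρ (ζ := 0) (by rw [zero_pow two_ne_zero, zero_mul]; positivity) m
  have hP1 := (coupled_letters hmono hL hb hlo hdom hh hf hk2 hk23 hk3K hρ hrk0 hrk hrjk0 hrjk hs hr (U := 0) (by omega) m).1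
  have hP2 := fun (U : ℕ) (hU : U + 1 ≤ k₂) => (coupled_letters hmono hL hb hlo hdom hh hf hk2 hk23 hk3K hρ hrk0 hrk hrjk0 hrjk hs hr hU m).2
  set σ := h (m + 1) / h (m + k₂) with hσ_def
  have hfin := hcond σ c1 ((k₂ : ℝ) * c2) ((k₃ : ℝ) * c3) hσ1 hσ2 hc10 (by positivity) (by positivity) hx3 hP1 hP2
  have hem := he0 m
  -- STEP 1: the old residual e − O ≥ (1 − x₃)e ≥ (1 − so)e ≥ 0
  have hOle : ∑ l ∈ range K, KL k₃ m l * ε (m + 1 + l) ≤ (k₃ : ℝ) * c3 * e m := by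
    calc ∑ l ∈ range K, KL k₃ m l * ε (m + 1 + l) ≤ ∑ l ∈ range K, KL k₃ m l * e m :=
          sum_le_sum fun l _ => mul_le_mul_of_nonneg_left
            (((IH _ (by omega)).2).trans (hea' m (m + 1 + l) (by omega))) (kernel_entry_le hL hh hg hKL k₃ m l).1
      _ = (∑ l ∈ range K, KL k₃ m l) * e m := by rw [sum_mul]
      _ ≤ (k₃ : ℝ) * c3 * e m := mul_le_mul_of_nonneg_right (row_mass_le hL hh hg hKL hk3K m) hem
  have hres1 : (1 - (k₃ : ℝ) * c3) * e m ≤ e m - ∑ l ∈ range K, KL k₃ m l * ε (m + 1 + l) := by linarith only [hOle]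
  have hz1 : (k₃ : ℝ) * c3 < 1 := lt_of_le_of_lt hx3 hso1
  have hres1' : 0 ≤ e m - ∑ l ∈ range K, KL k₃ m l * ε (m + 1 + l) := le_trans (mul_nonneg (by linarith) hem) hres1
  -- STEP 2: the young pair against the old read, first moment x + (k₂+1)y∕2, variation 4c₃ per lag
  have hWy : ∑ l ∈ range K, (KL 1 m l + KL k₂ m l) ≤ c1 + (k₂ : ℝ) * c2 := by
    rw [sum_add_distrib]
    have h1 : ∑ l ∈ range K, KL 1 m l ≤ c1 := by have := row_mass_le hL hh hg hKL h1K m; simpa using this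
    have h2 : ∑ l ∈ range K, KL k₂ m l ≤ (k₂ : ℝ) * c2 := row_mass_le hL hh hg hKL hk2K m
    linarith
  have hMy : ∑ l ∈ range K, (KL 1 m l + KL k₂ m l) * ((l : ℝ) + 1) ≤ c1 + ((k₂ : ℝ) + 1) / 2 * ((k₂ : ℝ) * c2) := by
    simp_rw [add_mul]
    rw [sum_add_distrib]
    have h1 := row_moment_le hL hh hg hKL h1K m
    have h2 := row_moment_le hL hh hg hKL hk2K m
    rw [← hc1_def] at h1
    rw [← hc2_def] at h2
    norm_num at h1
    have e : c2 * ((k₂ : ℝ) * ((k₂ : ℝ) + 1) / 2) = ((k₂ : ℝ) + 1) / 2 * ((k₂ : ℝ) * c2) := by ring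
    linarith
  have hstep := residual_step_moment (i := k₂) (Kw := K) (m := m) (sy := c1 + (k₂ : ℝ) * c2) (V := 4 * c3)
    (M₁ := c1 + ((k₂ : ℝ) + 1) / 2 * ((k₂ : ℝ) * c2))
    (wy := fun l => KL 1 m l + KL k₂ m l) (O := fun p => ∑ l ∈ range K, KL k₃ p l * ε (p + 1 + l)) (e := e) (ε := ε)
    (fun l => add_nonneg (kernel_entry_le hL hh hg hKL 1 m l).1 (kernel_entry_le hL hh hg hKL k₂ m l).1)
    (fun l hl => by rw [hKL, if_neg (by omega), hKL, if_neg (by omega), add_zero])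
    hWy hMy (by positivity) he0 hea
    (fun q hq => by
      have := hrec2 q
      have h1 := hreadY0 q hq.le
      linarith only [this, h1])
    hres1'
    (fun d hd1 hdj => by
      have hdk : d ≤ k₃ := by omega
      have hv' := old_read_variation hmono hL hb hlo hdom hh hf hL0 hg hgF hKL hk hk3K hd1 hdk he0 hea IH
      rw [← hc3_def] at hv'
      linarith only [hv'])
  -- assemble
  have hεm := hrec2 m
  refine ⟨?_, ?_⟩
  · have hM0 : 0 ≤ c1 + ((k₂ : ℝ) + 1) / 2 * ((k₂ : ℝ) * c2) := by positivity
    have hsy1 : 0 ≤ 1 - (c1 + (k₂ : ℝ) * c2) := by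
      have h4 : 0 ≤ 4 * ((k₃ : ℝ) * c3) / k₃ * (c1 + ((k₂ : ℝ) + 1) / 2 * ((k₂ : ℝ) * c2)) := by positivity
      have hprod : 0 ≤ (1 - (c1 + (k₂ : ℝ) * c2)) * (1 - (k₃ : ℝ) * c3) := by nlinarith [hfin, h4]
      exact (mul_nonneg_iff_of_pos_right (by linarith)).mp hprod
    have h1 := mul_le_mul_of_nonneg_left hres1 hsy1
    have h2 : (c1 + ((k₂ : ℝ) + 1) / 2 * ((k₂ : ℝ) * c2)) * (4 * c3) * e m
        = 4 * ((k₃ : ℝ) * c3) / k₃ * (c1 + ((k₂ : ℝ) + 1) / 2 * ((k₂ : ℝ) * c2)) * e m := by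
      field_simp
    have h3 : 0 ≤ ((1 - c1 - (k₂ : ℝ) * c2) * (1 - (k₃ : ℝ) * c3) - 4 * ((k₃ : ℝ) * c3) / k₃ * (c1 + ((k₂ : ℝ) + 1) / 2 * ((k₂ : ℝ) * c2))) * e m :=
      mul_nonneg hfin hem
    rw [hεm]
    nlinarith [hstep, h1, h2, h3]
  · rw [hεm]
    linarith only [hreadY0 m le_rfl, hreadO0 m le_rfl]

end Summit.QuantumFields.BalabanUV.Beta.EriceRemainderEnclosureHistoryAutonomyComparisonAgeCompositionYoungPairMomentCoupled

end
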